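import Summits.CriticalPhenomena.CardyFormulaZ2.Theorems.CardyFlipRussoVoronoiHubFromSmirnovUnitWInputs
import Summits.CriticalPhenomena.CardyFormulaZ2.Theorems.CardyFlipRussoVoronoiHubFromSmirnovPerSquareBound
import Summits.CriticalPhenomena.CardyFormulaZ2.Theorems.CardyFlipRussoVoronoiHubFromSmirnovScalesEventually
import Summits.CriticalPhenomena.CardyFormulaZ2.Theorems.CardyFlipRussoVoronoiHubFromSmirnovFSTendsto

/-!
# S3b-i CORE of line `moebius-exact-delaunay-dilation-ward`: GRAPH TRANSPORT FROM TASSION'S ONE-ARM DECAY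

Crux `VoronoiHubFromSmirnov` (stmt-CriticalPhenomena-6433), route `CardyFlipRusso`; the registered
skeleton stub `stub_graphTransportCore : VoronoiAnnealedOneArm → Sig.stub_graphTransport` (lead c3,
2026-08-17).  Benjamini–Schramm's Theorem 2.1 (Comm. Math. Phys. 197 (1998)) in graph form — for the
SAME Poisson nuclei, Euclidean and conformally pulled-back Delaunay chains cross a conformal
rectangle with probabilities differing by `o(1)` as the mesh `δ → 0⁺` — GIVEN the named Literature
fact `Literature.Probability.Percolation.VoronoiAnnealedOneArm` (Tassion, Ann. Probab. 44 (2016),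
Thm 3 (2): annealed, mesh-uniform polynomial decay of the black one-arm probability).

Proof = the one-arm route in the image domain (module docstrings of `…OneArmDefs`, `…UnitWInputs`):
`unitW_of_oneArm` (image-side core `Sig.unitW`, from `unitW_of_inputs` and its three analytic inputs
`perSquare_bound`, `scales_eventually`, `FS_tendsto_zero`), transported back to the domain side by the
law identity and no-void locality (`stub_graphTransport_of_unitW`).
-/

noncomputable section

namespace Summit.CriticalPhenomena.CardyFormulaZ2.Cruxes.VoronoiHubFromSmirnov.MoebiusExactDelaunayDilationWard

/-- **The image-side core from Tassion's one-arm decay**: for the homogeneous two-colour Poisson law,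
a univalent `g` near a conformal rectangle and admissible carrier / attachment families, the window
Euclidean graph crossing and the graph crossing for the adjacency pulled back through `g` have
probabilities differing by `o(1)` as `δ → 0⁺`. -/
theorem unitW_of_oneArm : Literature.Probability.Percolation.VoronoiAnnealedOneArm → Sig.unitW :=
  unitW_of_inputs perSquare_bound scales_eventually FS_tendsto_zero

/-- **S3b-i CORE** (registered skeleton stub of the line): graph transport — Benjamini–Schramm's
Theorem 2.1 in graph form for the inhomogeneous model `ρ = ‖h′‖²` and the pulled-back adjacency —
from Tassion's one-arm decay. -/
theorem stub_graphTransportCore : Literature.Probability.Percolation.VoronoiAnnealedOneArm → Sig.stub_graphTransport :=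
  fun h => stub_graphTransport_of_unitW (unitW_of_oneArm h)

end Summit.CriticalPhenomena.CardyFormulaZ2.Cruxes.VoronoiHubFromSmirnov.MoebiusExactDelaunayDilationWard

end
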